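import Mathlib.Analysis.Fourier.AddCircleMulti

/-!
# K1loc, line `Spectral` / thin start — helper: THE ENERGY-AWARE TRACE BOUND FOR THE CORNER-TRACE GRADE («TraceEnergy»)

Helper file of the prover lane on the crux `K1LocalisedCascade` (stmt-AnomalousDissipation-19491), route `SawtoothPulseCascade`
(glue seat; arbiter A23-11 (iv): the CT dischargers).  Companion of `…TraceInput`: the corner-trace bound
`…CornerTraceSum.cornerTrace_sum_sq_le` consumes, per block `F` of fibres, the traces `Σ_{n∈F} |T_n(y)|²`,
`T_n(y) = Σ_{l∈S} χ_l c(n,l) e^{2πily}` (`c(n,l)` = the source coefficient `l` on the fibre `n`).  `…TraceInput` bounds them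
INPUT-FREE by `(‖K_χ‖₁‖b‖_∞)²`; this file bounds them by the SOURCE-FIBRE ENERGIES inside the block (Minkowski in `ℓ²(F)`, no
kernel, no measure theory, any multiplier — in particular the sharp indicator):
  **`Σ_{n∈F} |Σ_{l∈S} χ_l c(n,l) e^{2πily}|² ≤ (Σ_{l∈S} |χ_l| (Σ_{n∈F} |c(n,l)|²)^{1/2})²**  (`sum_sq_trace_le_energy`).
For the early phases of the cascade, whose iterates have an explicit and very uneven fibre-energy profile (phase 1: the bulk of `a₁`
sits on nine `k₀`-fibres), this is the input that makes the corner-trace junk small (numbers: the lane's sizing memo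
`CT-PHASE1-SIZING-k1locp3g4.md`).  Also the elementary `ℓ²` Minkowski step it rests on (`sq_sum_norm_sum_le`) and the corner sum
(`sum_corner_traces_le_energy`).  No definitions; nothing about the crux. [cite: Grafakos2014, Prop. 3.1.2 (5), §3.1.3] [problem: turb]
-/

-- `Summit.<Summit>.<Problem>`: single-conjunct summit, the duplicate namespace segment is deliberate.
set_option linter.dupNamespace false

noncomputable section

namespace Summit.AnomalousDissipation.AnomalousDissipation.Theorems.SawtoothPulseCascade.K1Window

open Complex
open scoped Real

/-- **Minkowski in `ℓ²` of a finite set**: for vectors `u_l ∈ ℂ^F`, `Σ_{n∈F} ‖Σ_{l∈S} u_l(n)‖² ≤ (Σ_{l∈S} (Σ_{n∈F} ‖u_l(n)‖²)^{1/2})²`.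
[folklore] -/
theorem sq_sum_norm_sum_le (S F : Finset ℤ) (u : ℤ → ℤ → ℂ) :
    ∑ n ∈ F, ‖∑ l ∈ S, u l n‖ ^ 2 ≤ (∑ l ∈ S, Real.sqrt (∑ n ∈ F, ‖u l n‖ ^ 2)) ^ 2 := by
  set w : ℤ → ℂ := fun n => ∑ l ∈ S, u l n with hw
  set A2 : ℝ := ∑ n ∈ F, ‖w n‖ ^ 2 with hA2
  set Bsum : ℝ := ∑ l ∈ S, Real.sqrt (∑ n ∈ F, ‖u l n‖ ^ 2) with hBsum
  have hA2nn : 0 ≤ A2 := Finset.sum_nonneg fun n _ => sq_nonneg _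
  have hBnn : 0 ≤ Bsum := Finset.sum_nonneg fun l _ => Real.sqrt_nonneg _
  -- `A2 ≤ Bsum · √A2`
  have hkey : A2 ≤ Bsum * Real.sqrt A2 := by
    calc A2 = ∑ n ∈ F, ‖w n‖ * ‖w n‖ := Finset.sum_congr rfl fun n _ => by ring
      _ ≤ ∑ n ∈ F, (∑ l ∈ S, ‖u l n‖) * ‖w n‖ :=
          Finset.sum_le_sum fun n _ => mul_le_mul_of_nonneg_right (norm_sum_le _ _) (norm_nonneg _)
      _ = ∑ l ∈ S, ∑ n ∈ F, ‖u l n‖ * ‖w n‖ := by rw [Finset.sum_comm]; simp_rw [Finset.sum_mul]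
      _ ≤ ∑ l ∈ S, Real.sqrt (∑ n ∈ F, ‖u l n‖ ^ 2) * Real.sqrt (∑ n ∈ F, ‖w n‖ ^ 2) :=
          Finset.sum_le_sum fun l _ =>
            Real.sum_mul_le_sqrt_mul_sqrt F (fun n => ‖u l n‖) (fun n => ‖w n‖)
      _ = Bsum * Real.sqrt A2 := by rw [hBsum, hA2, Finset.sum_mul]
  have hsq : Real.sqrt A2 ^ 2 = A2 := Real.sq_sqrt hA2nn
  have h6 : Real.sqrt A2 ≤ Bsum := by
    by_cases h0 : Real.sqrt A2 = 0
    · rw [h0]; exact hBnn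
    · have hpos : 0 < Real.sqrt A2 := lt_of_le_of_ne (Real.sqrt_nonneg _) (Ne.symm h0)
      have h7 : Real.sqrt A2 * Real.sqrt A2 ≤ Bsum * Real.sqrt A2 := by rw [Real.mul_self_sqrt hA2nn]; exact hkey
      exact le_of_mul_le_mul_right h7 hpos
  calc ∑ n ∈ F, ‖w n‖ ^ 2 = A2 := rfl
    _ = Real.sqrt A2 ^ 2 := hsq.symm
    _ ≤ Bsum ^ 2 := pow_le_pow_left₀ (Real.sqrt_nonneg _) h6 2

/-- **ENERGY-AWARE TRACE BOUND.**  For any coefficient array `c(n,l)`, any multiplier `χ`, finite `S`, `F` and `y ∈ ℝ`: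
`Σ_{n∈F} |Σ_{l∈S} χ_l c(n,l) e^{2πily}|² ≤ (Σ_{l∈S} |χ_l|·(Σ_{n∈F} |c(n,l)|²)^{1/2})²` — the traces of a block of fibres are
controlled by the energies `E_l^F = Σ_{n∈F}|c(n,l)|²` of the source fibres inside the block. [cite: Grafakos2014, Prop. 3.1.2 (5), §3.1.3] -/
theorem sum_sq_trace_le_energy (c : ℤ → ℤ → ℂ) (χ : ℤ → ℂ) (S F : Finset ℤ) (y : ℝ) :
    ∑ n ∈ F, ‖∑ l ∈ S, χ l * c n l * cexp (2 * π * I * l * y)‖ ^ 2 ≤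
      (∑ l ∈ S, ‖χ l‖ * Real.sqrt (∑ n ∈ F, ‖c n l‖ ^ 2)) ^ 2 := by
  have he : ∀ l : ℤ, ‖cexp (2 * π * I * l * y)‖ = 1 := fun l => by
    rw [show (2 * π * I * l * y : ℂ) = ((2 * π * l * y : ℝ) : ℂ) * I by push_cast; ring, Complex.norm_exp_ofReal_mul_I]
  have h := sq_sum_norm_sum_le S F (fun l n => χ l * c n l * cexp (2 * π * I * l * y))
  refine h.trans (le_of_eq ?_)
  congr 1
  refine Finset.sum_congr rfl fun l _ => ?_
  have e1 : ∀ n, ‖χ l * c n l * cexp (2 * π * I * l * y)‖ ^ 2 = ‖χ l‖ ^ 2 * ‖c n l‖ ^ 2 := fun n => by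
    rw [norm_mul, norm_mul, he, mul_one, mul_pow]
  simp_rw [e1]
  rw [← Finset.mul_sum, Real.sqrt_mul (sq_nonneg _), Real.sqrt_sq (norm_nonneg _)]

/-- **The corner sum of the energy-aware bound**: summing over the `2N` corner points costs the factor `2N` —
`Σ_{r<N} (Σ_{n∈F}|T_n(y_r⁻)|² + Σ_{n∈F}|T_n(y_r⁺)|²) ≤ 2N·(Σ_l |χ_l| √E_l^F)²` for ANY corner abscissae. [folklore] -/
theorem sum_corner_traces_le_energy (c : ℤ → ℤ → ℂ) (χ : ℤ → ℂ) (S F : Finset ℤ) (N : ℕ) (y₁ y₂ : ℕ → ℝ) :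
    ∑ r ∈ Finset.range N, (∑ n ∈ F, ‖∑ l ∈ S, χ l * c n l * cexp (2 * π * I * l * y₁ r)‖ ^ 2 +
        ∑ n ∈ F, ‖∑ l ∈ S, χ l * c n l * cexp (2 * π * I * l * y₂ r)‖ ^ 2) ≤
      2 * N * (∑ l ∈ S, ‖χ l‖ * Real.sqrt (∑ n ∈ F, ‖c n l‖ ^ 2)) ^ 2 := by
  set Bd : ℝ := (∑ l ∈ S, ‖χ l‖ * Real.sqrt (∑ n ∈ F, ‖c n l‖ ^ 2)) ^ 2 with hBd
  calc ∑ r ∈ Finset.range N, (∑ n ∈ F, ‖∑ l ∈ S, χ l * c n l * cexp (2 * π * I * l * y₁ r)‖ ^ 2 +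
        ∑ n ∈ F, ‖∑ l ∈ S, χ l * c n l * cexp (2 * π * I * l * y₂ r)‖ ^ 2)
        ≤ ∑ r ∈ Finset.range N, (Bd + Bd) :=
          Finset.sum_le_sum fun r _ => add_le_add (sum_sq_trace_le_energy c χ S F (y₁ r)) (sum_sq_trace_le_energy c χ S F (y₂ r))
    _ = 2 * N * Bd := by rw [Finset.sum_const, Finset.card_range, nsmul_eq_mul]; ring

end Summit.AnomalousDissipation.AnomalousDissipation.Theorems.SawtoothPulseCascade.K1Window
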